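import Summits.CriticalPhenomena.PercolationContinuityZ3.Theorems.PercNearOneGluingNoHeavyLowerTailFreePeel
import Summits.CriticalPhenomena.PercolationContinuityZ3.Theorems.PercNearOneGluingNoHeavyLowerTailCoinReduction
import HarnessLib

/-!
# `NoHeavyLowerTail` (stmt-CriticalPhenomena-4575) — free-edge peeling is needed only for COIN-FREE observers

Support file (prover `prim-hp-8` gen 5, PL programme, technique tie/glue-locus exclusion; `--supports stmt-CriticalPhenomena-4575`).
No definitions, no named facts, no sorries.  Notation of `…CoinPatterns.lean` / `…FreePeel.lean`: observer `o ∉ A`, ranking `r` injective on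
`A` and compatible with lightness in `H` (the weights with the pairs at `o` switched off), `Φ_r(v) = Σ_{b∈A} μ_v(Sel_b)·μ_v(R_b) − μ_v(1 ≤ N ≤ j)`.

`…FreePeel.lean` reduces the crux to free-edge peeling

  `(FP)   Φ_r(w) ≥ (1 − w s(o,y))·Φ_r(w[s(o,y) ↦ 0])`      (`y` a non-relay neighbour of `o`)

asked for EVERY observer and EVERY `H`-compatible ranking `r`.  The ttrl2 census (cp-hp8 FINAL, `run/shared/lean/ttrl/pl/conjS/GLUESTEP.md`,
2026-08-19) shows that the glue-step `(B*)` — the `w s(o,y) → 0` end of (FP) — FAILS for SOME tie-breaks of the `H`-ranking, in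
`599 / 3.55·10¹⁰` glued and `12 / 6.8·10⁸` fractional exact cases, and that EVERY such failure has a RELAY neighbour ("coin") at `o` whose relay
sits in an `S^H`-tie class (the violating tie-breaks rank that class against the `G`-order); observers without relay neighbours: `0 / 2.76·10⁹`
glued + all fractional cells, all tie-breaks.  The tie locus is therefore excluded by removing the coins FIRST, which the coin reduction
(`CoinReduction.patternLightest_of_coinfree`, Lemma M + TOP'') does for free:

* `patternLightest_of_freePeel_coinFree` — if (FP) holds for every COIN-FREE weight function `w` agreeing with `v` off the pairs at `o`
  (`w s(o,c) = 0` for all `c ∈ A`) and every non-relay `y` with `w s(o,y) ≠ 0`, then `Φ_r(v) ≥ 0` for the ORIGINAL observer (coins allowed).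
* `noHeavyLowerTail_of_freePeel_coinFree` — typed target: (FP) for coin-free observers (all `H`-compatible rankings) ⇒ `NoHeavyLowerTail`.
  Its hypothesis is implied by that of `noHeavyLowerTail_of_freePeel` and avoids the refuted corner of the literal `∀`-ranking form.
-/

noncomputable section

namespace Summit.CriticalPhenomena.PercolationContinuityZ3.Theorems

namespace CoinReduction

open MeasureTheory Set Literature.Probability.LatticeModels Literature.Probability.Percolation
open scoped Classical BigOperators

variable {n : ℕ}

/-- **Coin-free free-edge peeling ⇒ the pattern-lightest bound.**  `o ∉ A`, `r` injective on `A` and `H`-compatible.  If for every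
COIN-FREE `w` (all relay pairs at `o` of weight `0`) agreeing with `v` off the pairs at `o` and every non-relay `y ≠ o` with `w s(o,y) ≠ 0`
one has `(1 − w s(o,y))·Φ_r(w[s(o,y)↦0]) ≤ Φ_r(w)`, then `Φ_r(v) ≥ 0`, i.e. `μ_v(1 ≤ N ≤ j) ≤ Σ_b μ_v(Sel_b)·μ_v(R_b)` — for the observer
WITH its coins.  [folklore — coins removed first by `patternLightest_of_coinfree` (coin reduction), then peeling of the coin-free observer] -/
theorem patternLightest_of_freePeel_coinFree (v : Sym2 (Fin n) → unitInterval) (A : Finset (Fin n)) (j : ℕ) (o : Fin n)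
    (r : Fin n → ℕ) (hr : Set.InjOn r ↑A) (hoA : o ∉ A)
    (hcompat : ∀ b ∈ A, ∀ b' ∈ A, r b < r b' →
      (prodBernoulli fun e : Sym2 (Fin n) => if e ∈ {e : Sym2 (Fin n) | o ∉ e} then v e else 0).real
          {ω : BondConfig (Fin n) | (A.filter fun z => ω ∈ openConn b' z).card ≤ j} ≤
        (prodBernoulli fun e : Sym2 (Fin n) => if e ∈ {e : Sym2 (Fin n) | o ∉ e} then v e else 0).real
          {ω : BondConfig (Fin n) | (A.filter fun z => ω ∈ openConn b z).card ≤ j})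
    (hpeel : ∀ (w : Sym2 (Fin n) → unitInterval) (y : Fin n), (∀ e : Sym2 (Fin n), o ∉ e → w e = v e) →
      (∀ c ∈ A, w s(o, c) = 0) →
      y ≠ o → y ∉ A → w s(o, y) ≠ 0 →
      (1 - (w s(o, y) : ℝ)) *
          (∑ b ∈ A, (prodBernoulli (Function.update w s(o, y) 0)).real {ω : BondConfig (Fin n) |
              b ∈ (A.filter fun b' => ω ∈ openConnIn ((↑A : Set (Fin n))ᶜ ∪ {b'}) o b') ∧
              ∀ b' ∈ A, r b' < r b → b' ∉ (A.filter fun b'' => ω ∈ openConnIn ((↑A : Set (Fin n))ᶜ ∪ {b''}) o b'')} *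
            (prodBernoulli (Function.update w s(o, y) 0)).real
              {ω : BondConfig (Fin n) | (A.filter fun z => ω ∈ openConn b z).card ≤ j} -
          (prodBernoulli (Function.update w s(o, y) 0)).real {ω : BondConfig (Fin n) |
            1 ≤ (A.filter fun z => ω ∈ openConn o z).card ∧ (A.filter fun z => ω ∈ openConn o z).card ≤ j}) ≤
        ∑ b ∈ A, (prodBernoulli w).real {ω : BondConfig (Fin n) |
            b ∈ (A.filter fun b' => ω ∈ openConnIn ((↑A : Set (Fin n))ᶜ ∪ {b'}) o b') ∧
            ∀ b' ∈ A, r b' < r b → b' ∉ (A.filter fun b'' => ω ∈ openConnIn ((↑A : Set (Fin n))ᶜ ∪ {b''}) o b'')} *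
          (prodBernoulli w).real {ω : BondConfig (Fin n) | (A.filter fun z => ω ∈ openConn b z).card ≤ j} -
        (prodBernoulli w).real {ω : BondConfig (Fin n) |
          1 ≤ (A.filter fun z => ω ∈ openConn o z).card ∧ (A.filter fun z => ω ∈ openConn o z).card ≤ j}) :
    (prodBernoulli v).real {ω : BondConfig (Fin n) |
        1 ≤ (A.filter fun z => ω ∈ openConn o z).card ∧ (A.filter fun z => ω ∈ openConn o z).card ≤ j} ≤
      ∑ b ∈ A, (prodBernoulli v).real {ω : BondConfig (Fin n) |
          b ∈ (A.filter fun b' => ω ∈ openConnIn ((↑A : Set (Fin n))ᶜ ∪ {b'}) o b') ∧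
          ∀ b' ∈ A, r b' < r b → b' ∉ (A.filter fun b'' => ω ∈ openConnIn ((↑A : Set (Fin n))ᶜ ∪ {b''}) o b'')} *
        (prodBernoulli v).real {ω : BondConfig (Fin n) | (A.filter fun z => ω ∈ openConn b z).card ≤ j} := by
  set Sel : Fin n → Set (BondConfig (Fin n)) := fun b => {ω |
    b ∈ (A.filter fun b' => ω ∈ openConnIn ((↑A : Set (Fin n))ᶜ ∪ {b'}) o b') ∧
    ∀ b' ∈ A, r b' < r b → b' ∉ (A.filter fun b'' => ω ∈ openConnIn ((↑A : Set (Fin n))ᶜ ∪ {b''}) o b'')} with hSel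
  set R : Fin n → Set (BondConfig (Fin n)) := fun b => {ω | (A.filter fun z => ω ∈ openConn b z).card ≤ j} with hR
  set L : Set (BondConfig (Fin n)) := {ω | 1 ≤ (A.filter fun z => ω ∈ openConn o z).card ∧
    (A.filter fun z => ω ∈ openConn o z).card ≤ j} with hL
  set Φ : (Sym2 (Fin n) → unitInterval) → ℝ :=
    fun w => ∑ b ∈ A, (prodBernoulli w).real (Sel b) * (prodBernoulli w).real (R b) - (prodBernoulli w).real L with hΦ
  -- the coin-free observer `vA`
  set vA : Sym2 (Fin n) → unitInterval := fun e => if ∃ c ∈ A, e = s(o, c) then 0 else v e with hvA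
  have hvA_off : ∀ e : Sym2 (Fin n), o ∉ e → vA e = v e := by
    intro e he
    have hne : ¬ ∃ c ∈ A, e = s(o, c) := by
      rintro ⟨c, _, rfl⟩
      exact he (Sym2.mem_mk_left o c)
    simp only [hvA, hne, if_false]
  have hvA_coin : ∀ c ∈ A, vA s(o, c) = 0 := by
    intro c hc
    have hex : ∃ c' ∈ A, s(o, c) = s(o, c') := ⟨c, hc, rfl⟩
    simp only [hvA, hex, if_true]
  -- peeling induction over COIN-FREE weight functions agreeing with `v` off the pairs at `o`
  suffices H : ∀ (k : ℕ) (w : Sym2 (Fin n) → unitInterval),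
      (Finset.univ.filter fun y : Fin n => y ≠ o ∧ w s(o, y) ≠ 0).card = k →
      (∀ e : Sym2 (Fin n), o ∉ e → w e = v e) → (∀ c ∈ A, w s(o, c) = 0) → 0 ≤ Φ w by
    have h := H _ vA rfl hvA_off hvA_coin
    have e0 : Φ vA = ∑ b ∈ A, (prodBernoulli vA).real (Sel b) * (prodBernoulli vA).real (R b) -
        (prodBernoulli vA).real L := rfl
    have hcf : (prodBernoulli vA).real L ≤ ∑ b ∈ A, (prodBernoulli vA).real (Sel b) * (prodBernoulli vA).real (R b) := by
      linarith
    exact patternLightest_of_coinfree v A j o r hr hoA hcompat hcf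
  have hagree : ∀ (w : Sym2 (Fin n) → unitInterval) (y : Fin n) (t : unitInterval),
      (∀ e : Sym2 (Fin n), o ∉ e → w e = v e) → ∀ e : Sym2 (Fin n), o ∉ e → Function.update w s(o, y) t e = v e := by
    intro w y t hw e he
    have hne : e ≠ s(o, y) := fun h => he (h ▸ Sym2.mem_mk_left o y)
    rw [Function.update_of_ne hne]; exact hw e he
  have hcoinfree : ∀ (w : Sym2 (Fin n) → unitInterval) (y : Fin n), y ∉ A →
      (∀ c ∈ A, w s(o, c) = 0) → ∀ c ∈ A, Function.update w s(o, y) 0 s(o, c) = 0 := by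
    intro w y hyA hw c hc
    by_cases hcy : s(o, c) = s(o, y)
    · rw [hcy, Function.update_self]
    · rw [Function.update_of_ne hcy]; exact hw c hc
  have hcount : ∀ (w : Sym2 (Fin n) → unitInterval) (y : Fin n), y ≠ o → w s(o, y) ≠ 0 →
      (Finset.univ.filter fun z : Fin n => z ≠ o ∧ Function.update w s(o, y) 0 s(o, z) ≠ 0).card <
      (Finset.univ.filter fun z : Fin n => z ≠ o ∧ w s(o, z) ≠ 0).card := by
    intro w y hyo hy0
    apply Finset.card_lt_card
    rw [Finset.ssubset_iff_of_subset]
    · refine ⟨y, Finset.mem_filter.2 ⟨Finset.mem_univ _, hyo, hy0⟩, ?_⟩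
      intro h
      have h' := (Finset.mem_filter.1 h).2.2
      rw [Function.update_self] at h'
      exact h' rfl
    · intro z hz
      have hz' := (Finset.mem_filter.1 hz).2
      refine Finset.mem_filter.2 ⟨Finset.mem_univ _, hz'.1, ?_⟩
      by_cases hzf : s(o, z) = s(o, y)
      · rw [hzf, Function.update_self] at hz'
        exact absurd rfl hz'.2
      · have h2 := hz'.2
        rwa [Function.update_of_ne hzf] at h2
  intro k
  induction k using Nat.strong_induction_on with
  | _ k ih =>
  intro w hk hw hwc
  by_cases hnz : ∃ y : Fin n, y ≠ o ∧ w s(o, y) ≠ 0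
  · obtain ⟨y, hyo, hy0⟩ := hnz
    -- `y` is not a relay: the observer is coin-free
    have hyA : y ∉ A := fun hyA => hy0 (hwc y hyA)
    have ih0 : 0 ≤ Φ (Function.update w s(o, y) 0) :=
      ih _ (by rw [← hk]; exact hcount w y hyo hy0) _ rfl (hagree w y 0 hw) (hcoinfree w y hyA hwc)
    have h1 : 0 ≤ 1 - (w s(o, y) : ℝ) := sub_nonneg.2 (w s(o, y)).2.2
    have e1 : Φ (Function.update w s(o, y) 0) =
        ∑ b ∈ A, (prodBernoulli (Function.update w s(o, y) 0)).real (Sel b) *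
          (prodBernoulli (Function.update w s(o, y) 0)).real (R b) - (prodBernoulli (Function.update w s(o, y) 0)).real L := rfl
    have e3 : Φ w = ∑ b ∈ A, (prodBernoulli w).real (Sel b) * (prodBernoulli w).real (R b) - (prodBernoulli w).real L := rfl
    have hstep := hpeel w y hw hwc hyo hyA hy0
    rw [← e1, ← e3] at hstep
    nlinarith [mul_nonneg h1 ih0]
  · -- base: the observer is isolated, `μ(L) = 0`
    push Not at hnz
    have hzero : ∀ y : Fin n, y ≠ o → ((w s(o, y) : unitInterval) : ℝ) = 0 := by
      intro y hyo
      rw [hnz y hyo]; rfl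
    have hL0 : (prodBernoulli w).real L = 0 := MergeStability.real_L_eq_zero_of_isolated w A o j hoA hzero
    change 0 ≤ ∑ b ∈ A, (prodBernoulli w).real (Sel b) * (prodBernoulli w).real (R b) - (prodBernoulli w).real L
    rw [hL0, sub_zero]
    exact Finset.sum_nonneg fun b _ => mul_nonneg measureReal_nonneg measureReal_nonneg

/-- **Typed target: free-edge peeling for COIN-FREE observers ⇒ `NoHeavyLowerTail`.**  Hypothesis (FP, coin-free form): for every
weighted graph on `Fin n`, relays `A`, observer `o ∉ A` with NO relay pair at `o` of nonzero weight, level `j`, injective `H`-compatible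
ranking `r`, and every non-relay `y ≠ o` with `w s(o,y) ≠ 0`:  `(1 − w s(o,y))·Φ_r(w[s(o,y) ↦ 0]) ≤ Φ_r(w)`.  Conclusion: the crux, through
`patternLightest_of_freePeel_coinFree` (coin reduction + peeling), `sum_sel_eq_sum_patterns`, `exists_compatible_ranking` and
`PatternLightest.noHeavyLowerTail_of_patternLightest`.  (Census: the coin-free form has no known violation for any tie-break of the
`H`-ranking; the form with coins at `o` fails on the `S^H` tie locus for some tie-breaks.) [folklore — reduction only; (FP) is open] -/
theorem noHeavyLowerTail_of_freePeel_coinFree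
    (hFP : ∀ (n : ℕ) (w : Sym2 (Fin n) → unitInterval) (A : Finset (Fin n)) (o y : Fin n) (j : ℕ) (r : Fin n → ℕ),
      o ∉ A → Set.InjOn r ↑A →
      (∀ b ∈ A, ∀ b' ∈ A, r b < r b' →
        (Literature.Probability.LatticeModels.prodBernoulli fun e : Sym2 (Fin n) =>
            if e ∈ {e : Sym2 (Fin n) | o ∉ e} then w e else 0).real
            {ω : Literature.Probability.Percolation.BondConfig (Fin n) |
              (A.filter fun z => ω ∈ Literature.Probability.Percolation.openConn b' z).card ≤ j} ≤
          (Literature.Probability.LatticeModels.prodBernoulli fun e : Sym2 (Fin n) =>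
            if e ∈ {e : Sym2 (Fin n) | o ∉ e} then w e else 0).real
            {ω : Literature.Probability.Percolation.BondConfig (Fin n) |
              (A.filter fun z => ω ∈ Literature.Probability.Percolation.openConn b z).card ≤ j}) →
      (∀ c ∈ A, w s(o, c) = 0) →
      y ≠ o → y ∉ A → w s(o, y) ≠ 0 →
      (1 - (w s(o, y) : ℝ)) *
          (∑ b ∈ A, (Literature.Probability.LatticeModels.prodBernoulli (Function.update w s(o, y) 0)).real
              {ω : Literature.Probability.Percolation.BondConfig (Fin n) |
                b ∈ (A.filter fun b' => ω ∈ Literature.Probability.Percolation.openConnIn ((↑A : Set (Fin n))ᶜ ∪ {b'}) o b') ∧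
                ∀ b' ∈ A, r b' < r b →
                  b' ∉ (A.filter fun b'' => ω ∈ Literature.Probability.Percolation.openConnIn ((↑A : Set (Fin n))ᶜ ∪ {b''}) o b'')} *
            (Literature.Probability.LatticeModels.prodBernoulli (Function.update w s(o, y) 0)).real
              {ω : Literature.Probability.Percolation.BondConfig (Fin n) |
                (A.filter fun z => ω ∈ Literature.Probability.Percolation.openConn b z).card ≤ j} -
          (Literature.Probability.LatticeModels.prodBernoulli (Function.update w s(o, y) 0)).real
            {ω : Literature.Probability.Percolation.BondConfig (Fin n) |
              1 ≤ (A.filter fun z => ω ∈ Literature.Probability.Percolation.openConn o z).card ∧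
              (A.filter fun z => ω ∈ Literature.Probability.Percolation.openConn o z).card ≤ j}) ≤
        ∑ b ∈ A, (Literature.Probability.LatticeModels.prodBernoulli w).real
            {ω : Literature.Probability.Percolation.BondConfig (Fin n) |
              b ∈ (A.filter fun b' => ω ∈ Literature.Probability.Percolation.openConnIn ((↑A : Set (Fin n))ᶜ ∪ {b'}) o b') ∧
              ∀ b' ∈ A, r b' < r b →
                b' ∉ (A.filter fun b'' => ω ∈ Literature.Probability.Percolation.openConnIn ((↑A : Set (Fin n))ᶜ ∪ {b''}) o b'')} *
          (Literature.Probability.LatticeModels.prodBernoulli w).real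
            {ω : Literature.Probability.Percolation.BondConfig (Fin n) |
              (A.filter fun z => ω ∈ Literature.Probability.Percolation.openConn b z).card ≤ j} -
        (Literature.Probability.LatticeModels.prodBernoulli w).real
          {ω : Literature.Probability.Percolation.BondConfig (Fin n) |
            1 ≤ (A.filter fun z => ω ∈ Literature.Probability.Percolation.openConn o z).card ∧
            (A.filter fun z => ω ∈ Literature.Probability.Percolation.openConn o z).card ≤ j}) :
    Summit.CriticalPhenomena.PercolationContinuityZ3.Theses.PercNearOneGluing.NoHeavyLowerTail := by
  apply PatternLightest.noHeavyLowerTail_of_patternLightest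
  intro n w A o j hoA
  obtain ⟨r, hr, hcompat⟩ := exists_compatible_ranking
    (fun b => (prodBernoulli fun e : Sym2 (Fin n) => if e ∈ {e : Sym2 (Fin n) | o ∉ e} then w e else 0).real
      {ω : BondConfig (Fin n) | (A.filter fun z => ω ∈ openConn b z).card ≤ j}) A
  have hex : ∀ B : Finset (Fin n), B.Nonempty → ∃ b ∈ B, ∀ b' ∈ B, r b ≤ r b' :=
    fun B hB => Finset.exists_min_image B r hB
  set sel : Finset (Fin n) → Fin n := fun B => if h : B.Nonempty then Classical.choose (hex B h) else o with hseldef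
  have hsel : ∀ B : Finset (Fin n), B.Nonempty → sel B ∈ B ∧ ∀ b ∈ B, r (sel B) ≤ r b := by
    intro B hB
    have h := Classical.choose_spec (hex B hB)
    simp only [hseldef, dif_pos hB]
    exact ⟨h.1, h.2⟩
  refine ⟨sel, fun B hB => (hsel B (Finset.nonempty_iff_ne_empty.2 (Finset.ne_of_mem_erase hB))).1, ?_⟩
  have key := sum_sel_eq_sum_patterns (prodBernoulli w) A o r hr sel hsel
    (fun b => (prodBernoulli w).real {ω : BondConfig (Fin n) | (A.filter fun x => ω ∈ openConn b x).card ≤ j})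
  rw [← key]
  have hres : ∀ w' : Sym2 (Fin n) → unitInterval, (∀ e : Sym2 (Fin n), o ∉ e → w' e = w e) →
      (fun e : Sym2 (Fin n) => if e ∈ {e : Sym2 (Fin n) | o ∉ e} then w' e else 0) =
        fun e : Sym2 (Fin n) => if e ∈ {e : Sym2 (Fin n) | o ∉ e} then w e else 0 := by
    intro w' hw'
    funext e
    by_cases he : e ∈ {e : Sym2 (Fin n) | o ∉ e}
    · simp only [he, if_true]; exact hw' e he
    · simp only [he, if_false]
  apply patternLightest_of_freePeel_coinFree w A j o r hr hoA hcompat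
  intro w' y hw' hwc hyo hyA hwy
  exact hFP n w' A o y j r hoA hr (by rw [hres w' hw']; exact hcompat) hwc hyo hyA hwy

end CoinReduction

end Summit.CriticalPhenomena.PercolationContinuityZ3.Theorems

end
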